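import Summits.BirchSwinnertonDyer.BirchSwinnertonDyer.Theorems.GenusKolyvaginAtTwoMinimalTwinBSDTwoAnalyticSplit
import Summits.BirchSwinnertonDyer.BirchSwinnertonDyer.Theorems.GenusKolyvaginAtTwoGenusPrimitiveSupplyAtTwoTwistingPrime
import Summits.BirchSwinnertonDyer.BirchSwinnertonDyer.Theorems.GenusKolyvaginAtTwoGenusPrimitiveSupplyAtTwoPrimeHeegnerTwinSilentPrimes
import Summits.BirchSwinnertonDyer.BirchSwinnertonDyer.Theorems.GenusKolyvaginAtTwoMinimalTwinBSDTwoOrdinaryTwist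
import Summits.BirchSwinnertonDyer.BirchSwinnertonDyer.Theses.TwoAdicConverse
import Summits.BirchSwinnertonDyer.Rank1Residual.Additive.TwistRamTransport
import Literature.NumberTheory.EllipticCurves.ComplexMultiplicationHasCMProofs
import Literature.NumberTheory.EllipticCurves.SelmerCardinalityPConverses
import Literature.NumberTheory.EllipticCurves.TwoAdicImageSurjectivityModTwoProofs
import Literature.NumberTheory.EllipticCurves.LFunctionSmulProofs
import HarnessLib

/-!
# Route `GenusKolyvaginAtTwo` (rev 59), crux U₂ `MinimalTwinBSDTwo` (stmt-BirchSwinnertonDyer-22985): THE TWO L-VALUE SUPPLIES NV⁺ / NV⁻ OF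
# U₂|`closes` ARE THE RANK-ZERO 2-CONVERSE OF THE TWIN — priced BY NAME by route `TwoAdicConverse`'s items stmt-BirchSwinnertonDyer-19218
# `GoodOrdinaryRankZeroTwoConverse` / stmt-BirchSwinnertonDyer-19219 `MultiplicativeRankZeroTwoConverse`, at Čebotarev primes that EXIST by tree theorems

Seat `bsd-line-gk2-p3` g30 (PROVER seat 3/3, cell `bsd-f1-sign2`), `--supports stmt-BirchSwinnertonDyer-22985` (helper; closes nothing).
THEOREMS ONLY (no definition, no named fact, no `sorry`); standard axioms.  **BSD is NOT proved by this file; U₂, the wall, the 2-converse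
items, EXP and `S_id` are NOT proved; no item is closed.**  Every theorem is CONDITIONAL on its displayed hypotheses.

WHY.  This lineage's NV/EXP ledger (p773745 `…AnalyticSplit`) displays U₂|`closes` ⟸ WALL + NV⁺ + EXP⁺ + NV⁻ + EXP⁻ + `S_id` + PRINT, with
NV± = «SOME prime `ℓ` in an explicit Čebotarev-type class has `L(W^{(−ℓ)},1) ≠ 0`» (NV⁻: `Δ_W < 0`, `ℓ ≡ 7 (8)`, `−ℓ` Heegner, `Sel₂(W)` not
strict at `ℓ`; NV⁺: `Δ_W > 0` on the egg, `−ℓ` Heegner, `2`-division cubic rootless mod `ℓ`).  REF2 placed them (REF2-PLACEMENT-v61 §3.4): NV⁻ is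
NOT IN PRINT, its algebraic shadow `Sel₂(W^{(−ℓ)}) = 0` leaving EXACTLY the rank-`0` `2`-converse (Kriz–Li 2019 Rem. 1.14).  Here that placement
becomes kernel theorems BY NAME: (1) both Čebotarev classes are NON-EMPTY beyond every bound by tree THEOREMS (gk2-p4's twisting primes
`GenusKolyTwistingPrime.exists_twistingPrime_not_selmerGroup_le_strictLocalKer`, gk2's `GenusKolyTwin.exists_silent_prime_heegnerField`; unconditional
Čebotarev `Automorphic.chebotarev_artinRep_holds`); (2) at such a prime a globally minimal model `Wd ≅ W^{(−ℓ)}` has `#Sel₂(Wd) = 1` — the door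
(`Door.natCard_selmerGroup_twin_eq_one_of_not_strict`, p770370, unconditional) resp. the egg (`Egg.natCard_selmerGroup_twin_eq_one_of_meetsEgg_of_silent`,
p770721) — so `corank_{ℤ₂} Sel_{2^∞}(Wd) = 0` (Cassels–Tate over `ℚ`, tree theorem `exists_casselsTate_pairing_holds`); (3) `Wd` is non-CM (`j` is a
twist invariant) and good-ordinary resp. multiplicative at `2` when `W` is (`−ℓ ≡ 1 (4)` is a `2`-adic unit: this lineage's route-independent
`OrdinaryTwistAtTwo.isOrdinaryAt_two_iff_of_smul_quadraticTwist_of_emod_four_eq_one`, g6, and the `Rank1Residual` library's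
`Additive.mult_iff_of_twist_pStar`), so the ITEMS give `r_an(Wd) = 0`, i.e. `L(W^{(−ℓ)},1) ≠ 0` (`analyticRank_eq_zero_iff_holds`, `entireLFunction_smul`).
So NV∓ restricted to `W` good-ordinary or multiplicative at `2` follow from the two items + GZK + `hasEntireLFunction_rat`, and VERBATIM once a
rank-`0` `2`-converse off the semistable-ordinary locus at `2` (the rank-`0` analogue of the route's declared residual
`RankOneTwoConverseOffSemistableAtTwo`; nobody's item) is added; the ledger reads **U₂|`closes` ⟸ WALL + CONV₀ (= stmt-19218 + stmt-19219 +
off-semistable residual) + EXP⁺ + EXP⁻ + `S_id` + PRINT** — U₂ has NO independent L-value input left; one pair of EXISTING items of a sibling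
route serves it.  The only module of route `TwoAdicConverse` imported is its route FILE (for the two names); every lemma used is route-independent.
Nothing here is progress on BSD: EXP± (the 2-adic exponent of `y_K`, lossless) and the wall remain the `BSD₂` content.

* §0 packages: `rank_eq_one_and_surj_of_natCard_selmerGroup_eq_two_of_GZK`; the two Sel₂-TRIVIAL TWIN PACKAGES
  `exists_doorPrime_heegnerField_selmerTrivialTwin` (`Δ < 0`, unconditional) and `exists_silentPrime_heegnerField_selmerTrivialTwin_of_GZK`
  (egg); class transport `not_hasCM_and_semistableOrdinary_twin_of_discr_eq_neg_prime`; the L-value steps `entireLFunction_twist_one_ne_zero_…`.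
* §1 NV⁻: `nonvanishingDoor_of_rankZeroTwoConverses_of_facts` (items only, `GoodOrd ∨ Mult` at `2`), `nonvanishingDoor_of_rankZeroTwoConverse_of_facts`
  (VERBATIM, from the three-piece converse `rankZeroTwoConverse_of_items_of_offSemistable`).  §2 NV⁺: the same two shapes.
* The ledger itself (U₂|`closes` ⟸ WALL + CONV₀ + EXP± + `S_id` + PRINT, on p773745's §4) is the companion file `…MinimalTwinBSDTwoConverseLedger`.

References: [MazurRubin2010] Prop. 3.3, Cor. 3.4 (i), Lemma 3.5; [Kramer1981] §2 Props. 3, 6; [KrizLi2019] Rem. 1.14; [GrossLMS1991] §1, §9;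
[SilvermanAEC2009] VII.5 Prop. 5.1, X.4 Thm. 4.2, X.4.14, App. C §16; [DokchitserDokchitserMathZ2012] Theorem (1);
[BirchSwinnertonDyer1965]; [SerreAbelianLadic1968] I §2.2.
-/

set_option autoImplicit false
set_option linter.dupNamespace false -- `Summit.<P>.<Sub>` repeats `BirchSwinnertonDyer` (D-0017)

noncomputable section

open scoped Classical

open WeierstrassCurve NumberField Literature.NumberTheory.EllipticCurves
  Literature.NumberTheory.EllipticCurves.ModularForms
  Literature.NumberTheory.EllipticCurves.Rank1Residual
  Literature.NumberTheory.QuadraticFields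
  Summit.BirchSwinnertonDyer.Rank1Residual
  Summit.BirchSwinnertonDyer.Rank1Residual.AdditivePotMult
  Summit.BirchSwinnertonDyer.Rank1Residual.F1Sign2
  Summit.BirchSwinnertonDyer.BirchSwinnertonDyer.Rank1Residual
  Summit.BirchSwinnertonDyer.BirchSwinnertonDyer.Theses.GenusKolyvaginAtTwo
  Summit.BirchSwinnertonDyer.BirchSwinnertonDyer.Theorems
  Summit.BirchSwinnertonDyer.BirchSwinnertonDyer.Theorems.GenusExact.TwinSwap

open Summit.BirchSwinnertonDyer.BirchSwinnertonDyer.Theses.TwoAdicConverse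
  (GoodOrdinaryRankZeroTwoConverse MultiplicativeRankZeroTwoConverse)

namespace Summit.BirchSwinnertonDyer.BirchSwinnertonDyer.Theorems.GenusExact.TwinSwap.Ledger.Line25

/-! ## §0 Packages: rank/surjectivity, the two Sel₂-trivial twin packages, class transport, the L-value step -/

/-- **`#Sel₂(W) = 2` and `r_an(W) = 1` ⟹ rank `1` and (on `Δ_W < 0`) `ρ̄_{W,2}` onto** (mod GZK): GZK turns `r_an = 1` into
rank `1`, the descent count `#Sel₂ = 2^rank · #W(ℚ)[2] · #(Ш ⊓ H¹[2])` kills the `2`-torsion (`rank_eq_one_and_sha_primary_eq_zero_of_natCard_selmerGroup_eq_two`),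
and a negative discriminant is not a square, so Dokchitser–Dokchitser's criterion (`hasSurjectiveModNGaloisRep_two_iff`, PROVED in the tree)
gives surjectivity mod `2`.  CONDITIONAL on GZK.  [cite: SilvermanAEC2009, X.4 Thm. 4.2] [cite: DokchitserDokchitserMathZ2012, Theorem (1)] -/
theorem rank_eq_one_and_surj_of_natCard_selmerGroup_eq_two_of_GZK
    (hGZK : rank_eq_analyticRank_of_analyticRank_le_one)
    (W : WeierstrassCurve ℚ) [W.IsElliptic] (hr : W.analyticRank = 1) (hSel : Nat.card (W.selmerGroup 2) = 2) :
    W.mordellWeilRank = 1 ∧ (W.Δ < 0 → W.HasSurjectiveModNGaloisRep 2) := by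
  have hrk : W.mordellWeilRank = W.analyticRank := (hGZK W (by omega)).1
  obtain ⟨hrk1, hT, -⟩ := rank_eq_one_and_sha_primary_eq_zero_of_natCard_selmerGroup_eq_two W hSel (by omega)
  refine ⟨hrk1, fun hΔ ↦ (hasSurjectiveModNGaloisRep_two_iff W).mpr ⟨?_, ?_⟩⟩
  · -- (`convert` bridges the two `DecidableEq ℚ` instances behind the group law on `W(ℚ)`)
    convert hT
  · rintro ⟨r, hr2⟩
    nlinarith [mul_self_nonneg r]

/-- **THE DOOR-PRIME TWIN PACKAGE — UNCONDITIONAL.**  `W/ℚ` globally minimal elliptic with `Δ_W < 0`, `ρ̄_{W,2}` onto, `#Sel₂(W) = 2`: there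
are a prime `ℓ` (gk2-p4's twisting prime: `ℓ ≡ 7 (8)`, `p ∣ N_W ⟹ p ∣ ℓ + 1`, `Sel₂(W)` NOT strict at `ℓ` — Čebotarev is a tree theorem), the
prime Heegner field `K = ℚ(√−ℓ)` (imaginary quadratic, `d_K = −ℓ` odd `≠ −3`, Heegner for `N_W`, `2` split: gk2's
`GenusKolyTwin.exists_heegnerField_of_prime`) and a GLOBALLY MINIMAL model `Wd ≅ W^{(d_K)}` with **`#Sel₂(Wd) = 1`** (the door, p770370).  In
particular NV⁻'s Čebotarev class is non-empty — its only residual content is the `L`-value.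
[cite: MazurRubin2010, Prop. 3.3, Cor. 3.4 (i), Lemma 3.5] [cite: GrossLMS1991, §1 (p. 235), §9] [cite: SilvermanAEC2009, VIII.8.3] -/
theorem exists_doorPrime_heegnerField_selmerTrivialTwin
    (W : WeierstrassCurve ℚ) [W.IsElliptic] [W.IsGloballyMinimal] [NeZero (W.conductorNorm ℤ)]
    (hΔ : W.Δ < 0) (hsurj : W.HasSurjectiveModNGaloisRep 2) (hSel : Nat.card (W.selmerGroup 2) = 2) :
    ∃ (K : Type) (_ : Field K) (_ : NumberField K) (ℓ : ℕ) (_ : Fact ℓ.Prime),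
      IsImaginaryQuadratic K ∧ NumberField.discr K = -(ℓ : ℤ) ∧ ¬ W.selmerGroup 2 ≤ MazurRubin2010.strictLocalKer W ℚ_[ℓ] 2 ∧
      Odd (NumberField.discr K) ∧ NumberField.discr K ≠ -3 ∧ SatisfiesHeegnerHypothesis (W.conductorNorm ℤ) K ∧
      ((Ideal.span {(2 : ℤ)}).primesOver (𝓞 K)).ncard = 2 ∧ NumberField.discr K % 4 = 1 ∧
      ∃ (Wd : WeierstrassCurve ℚ) (_ : Wd.IsElliptic) (_ : Wd.IsGloballyMinimal) (Cd : VariableChange ℚ),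
        Cd • W.quadraticTwist (NumberField.discr K : ℚ) = Wd ∧ Nat.card (Wd.selmerGroup 2) = 1 := by
  have hN : W.conductorNorm ℤ ≠ 0 := NeZero.ne _
  have hSel1 : Nat.card (W.selmerGroup 2) ≠ 1 := by rw [hSel]; norm_num
  obtain ⟨ℓ, hℓF, -, -, hℓ8, hℓp, hns⟩ :=
    GenusKolyTwistingPrime.exists_twistingPrime_not_selmerGroup_le_strictLocalKer W hsurj hΔ hSel1 hN 0
  haveI := hℓF
  have hℓ : ℓ.Prime := hℓF.out
  have hℓN' : ∀ p : ℕ, p.Prime → p ∣ W.conductorNorm ℤ → p ≠ 2 → (ℓ : ZMod p) = -1 := by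
    intro p _ hp _
    have h : ((ℓ + 1 : ℕ) : ZMod p) = 0 := (ZMod.natCast_eq_zero_iff _ _).mpr (hℓp p hp)
    rw [Nat.cast_add, Nat.cast_one] at h
    exact eq_neg_of_add_eq_zero_left h
  obtain ⟨-, -, K, iF, iN, hK, hd, hodd, h3, hH, h2K, -, -⟩ := GenusKolyTwin.exists_heegnerField_of_prime W hℓ hℓ8 hℓN'
  have hD0 : (NumberField.discr K : ℚ) ≠ 0 := by exact_mod_cast NumberField.discr_ne_zero K
  obtain ⟨Wd, iE, iM, Cd, hCd⟩ := exists_globallyMinimal_model_twist W hD0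
  have hSelWd : Nat.card (Wd.selmerGroup 2) = 1 :=
    Door.natCard_selmerGroup_twin_eq_one_of_not_strict W hΔ hSel hK hodd hH h2K hd Wd ⟨Cd, hCd⟩ hns
  exact ⟨K, iF, iN, ℓ, hℓF, hK, hd, hns, hodd, h3, hH, h2K, Quadratic.discr_emod_four_eq_one hK.1 hodd, Wd, iE, iM, Cd, hCd, hSelWd⟩

/-- **THE SILENT-PRIME TWIN PACKAGE ON THE EGG** (mod GZK, used only for rank `1`).  `W/ℚ` globally minimal elliptic with `Δ_W > 0`,
`ρ̄_{W,2}` onto, `r_an(W) = 1`, `#Sel₂(W) = 2`, MEETING THE EGG: there are a prime `ℓ` with the `2`-division cubic ROOTLESS mod `ℓ` (gk2's silent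
prime, `ℓ ≡ 7 (8)`; Čebotarev is a tree theorem), the prime Heegner field `K = ℚ(√−ℓ)` (`d_K = −ℓ` odd `≠ −3`, Heegner for `N_W`) and a GLOBALLY
MINIMAL model `Wd ≅ W^{(d_K)}` with **`#Sel₂(Wd) = 1`** (silent twin, p767915; the egg decides, p770721).
[cite: Kramer1981, §2 Props. 3, 6] [cite: MazurRubin2010, Cor. 3.4 (i)] [cite: SerreAbelianLadic1968, Ch. I §2.2, Cor. 2 (a)] -/
theorem exists_silentPrime_heegnerField_selmerTrivialTwin_of_GZK (hGZK : rank_eq_analyticRank_of_analyticRank_le_one)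
    (W : WeierstrassCurve ℚ) [W.IsElliptic] [W.IsGloballyMinimal]
    (hΔ : 0 < W.Δ) (hsurj : W.HasSurjectiveModNGaloisRep 2) (hr : W.analyticRank = 1) (hSel : Nat.card (W.selmerGroup 2) = 2)
    (hegg : MeetsEgg W) :
    ∃ (K : Type) (_ : Field K) (_ : NumberField K) (ℓ : ℕ), ℓ.Prime ∧
      IsImaginaryQuadratic K ∧ NumberField.discr K = -(ℓ : ℤ) ∧
      (∀ x : ZMod ℓ, 4 * x ^ 3 + ((integralModelInt W).b₂ : ZMod ℓ) * x ^ 2 +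
        2 * ((integralModelInt W).b₄ : ZMod ℓ) * x + ((integralModelInt W).b₆ : ZMod ℓ) ≠ 0) ∧
      Odd (NumberField.discr K) ∧ NumberField.discr K ≠ -3 ∧ SatisfiesHeegnerHypothesis (W.conductorNorm ℤ) K ∧
      NumberField.discr K % 4 = 1 ∧
      ∃ (Wd : WeierstrassCurve ℚ) (_ : Wd.IsElliptic) (_ : Wd.IsGloballyMinimal) (Cd : VariableChange ℚ),
        Cd • W.quadraticTwist (NumberField.discr K : ℚ) = Wd ∧ Nat.card (Wd.selmerGroup 2) = 1 := by
  obtain ⟨hrk1, -⟩ := rank_eq_one_and_surj_of_natCard_selmerGroup_eq_two_of_GZK hGZK W hr hSel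
  obtain ⟨ℓ, -, hℓ, -, -, hsil, -, -, K, iF, iN, hK, hd, hodd, h3, hH, -, -, -⟩ :=
    GenusKolyTwin.exists_silent_prime_heegnerField W hΔ hsurj 0
  have hD0 : (NumberField.discr K : ℚ) ≠ 0 := by exact_mod_cast NumberField.discr_ne_zero K
  obtain ⟨Wd, iE, iM, Cd, hCd⟩ := exists_globallyMinimal_model_twist W hD0
  have hSil : padicValNat 2 Wd.tamagawaProduct = padicValNat 2 W.tamagawaProduct :=
    Silent.padicValNat_two_tamagawaProduct_twin_eq_of_discr_eq_neg_prime_of_noRoot W hK hodd hH hℓ hd hsil Cd hCd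
  have hSelWd : Nat.card (Wd.selmerGroup 2) = 1 :=
    Egg.natCard_selmerGroup_twin_eq_one_of_meetsEgg_of_silent W hK hodd hH hΔ hsurj hrk1 hSel Cd hCd hSil hegg
  exact ⟨K, iF, iN, ℓ, hℓ, hK, hd, hsil, hodd, h3, hH, Quadratic.discr_emod_four_eq_one hK.1 hodd, Wd, iE, iM, Cd, hCd, hSelWd⟩

/-- **The twin by a prime Heegner discriminant stays in the class «non-CM, good-ordinary or multiplicative at `2`», with the same
reduction type.**  `W/ℚ` globally minimal elliptic, `ℓ` an odd prime with `−ℓ ≡ 1 (mod 4)`, `Wd` a globally minimal model of `W^{(−ℓ)}`: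
`Wd` is non-CM iff `W` is (`j(W^{(d)}) = j(W)`, `HasCM` depends only on `j`: `hasCM_iff_of_j_eq`), good-ordinary at `2` iff `W` is (twist by a
`2`-adic unit `≡ 1 (4)`: `OrdinaryTwistAtTwo.isOrdinaryAt_two_iff_of_smul_quadraticTwist_of_emod_four_eq_one`, route-independent, g6), and
multiplicative at `2` iff `W` is (`−ℓ = ℓ*` is a unit at `2 ≠ ℓ`: `Rank1Residual.Additive.mult_iff_of_twist_pStar`).
[cite: SilvermanAEC2009, VII.5 Prop. 5.1 (b), X.5 Cor. 5.4, App. C §11] [cite: Pal2012, Prop. 2.5] -/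
theorem not_hasCM_and_semistableOrdinary_twin_of_discr_eq_neg_prime
    (W : WeierstrassCurve ℚ) [W.IsElliptic] [W.IsGloballyMinimal] (hcm : ¬ W.HasCM) (hred : GoodOrd W 2 ∨ Mult W 2)
    {ℓ : ℕ} (hℓ : ℓ.Prime) {d : ℤ} (hdℓ : d = -(ℓ : ℤ)) (hd4 : d % 4 = 1)
    (Wd : WeierstrassCurve ℚ) [Wd.IsElliptic] [Wd.IsGloballyMinimal]
    {Cd : VariableChange ℚ} (hCd : Cd • W.quadraticTwist (d : ℚ) = Wd) :
    ¬ Wd.HasCM ∧ ((GoodOrd W 2 → GoodOrd Wd 2) ∧ (Mult W 2 → Mult Wd 2)) ∧ (GoodOrd Wd 2 ∨ Mult Wd 2) := by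
  haveI : Fact (Nat.Prime 2) := ⟨Nat.prime_two⟩
  haveI : Fact ℓ.Prime := ⟨hℓ⟩
  have hd0 : ((d : ℤ) : ℚ) ≠ 0 := by exact_mod_cast (show d ≠ 0 by omega)
  haveI := W.isElliptic_quadraticTwist hd0
  -- non-CM: `j(Wd) = j(W^{(d)}) = j(W)`
  have hj : Wd.j = W.j := by
    subst hCd
    rw [variableChange_j, W.j_quadraticTwist hd0]
  have hcm' : ¬ Wd.HasCM := fun h ↦ hcm ((hasCM_iff_of_j_eq hj).mp h)
  -- good ordinary at `2`: `d ≡ 1 (4)` (the predicates `GoodOrd` and `IsOrdinaryAt` have the same body)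
  have hgo : GoodOrd W 2 → GoodOrd Wd 2 := fun h ↦
    (OrdinaryTwistAtTwo.isOrdinaryAt_two_iff_of_smul_quadraticTwist_of_emod_four_eq_one W Wd hd4 hCd).mpr h
  -- multiplicative at `2`: `d = ℓ* = 4k + 1`, `2 ≠ ℓ`
  have hℓ2 : (2 : ℕ) ≠ ℓ := by rintro rfl; omega
  have hm : Mult W 2 → Mult Wd 2 := fun h ↦
    (Additive.mult_iff_of_twist_pStar ℓ W (d := d) (k := (d - 1) / 4) (by omega) (Or.inr hdℓ) Cd hCd hℓ2).mpr h
  exact ⟨hcm', ⟨hgo, hm⟩, hred.imp hgo hm⟩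

/-- **From `#Sel₂(Wd) = 1` to `L(W^{(−ℓ)},1) ≠ 0` through the rank-zero `2`-converse** (the step common to both cells).  `W/ℚ` globally
minimal, non-CM, good-ordinary or multiplicative at `2`; `ℓ` prime with `d = −ℓ ≡ 1 (mod 4)`; `Wd` a globally minimal model of `W^{(d)}` with
`#Sel₂(Wd) = 1`.  Then `corank_{ℤ₂} Sel_{2^∞}(Wd) = 0` (Cassels–Tate over `ℚ`, tree theorem `exists_casselsTate_pairing_holds`), `Wd` is non-CM
and in the same reduction class at `2` (`not_hasCM_and_semistableOrdinary_twin_of_discr_eq_neg_prime`), the ITEMS `GoodOrdinaryRankZeroTwoConverse`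
(stmt-19218) / `MultiplicativeRankZeroTwoConverse` (stmt-19219) give `r_an(Wd) = 0`, and `L(W^{(d)},1) = L(Wd,1) ≠ 0`
(`analyticRank_eq_zero_iff_holds`, `entireLFunction_smul`).  CONDITIONAL on the two items and `hasEntireLFunction_rat`.
[cite: SilvermanAEC2009, X.4 Thm. 4.2 and Thm. 4.14, VII.5 Prop. 5.1, App. C §16] [cite: BirchSwinnertonDyer1965] -/
theorem entireLFunction_twist_one_ne_zero_of_rankZeroTwoConverses_of_natCard_selmerGroup_eq_one
    (hC0g : GoodOrdinaryRankZeroTwoConverse) (hC0m : MultiplicativeRankZeroTwoConverse) (hmod : hasEntireLFunction_rat)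
    (W : WeierstrassCurve ℚ) [W.IsElliptic] [W.IsGloballyMinimal] (hcm : ¬ W.HasCM) (hred : GoodOrd W 2 ∨ Mult W 2)
    {ℓ : ℕ} (hℓ : ℓ.Prime) {d : ℤ} (hdℓ : d = -(ℓ : ℤ)) (hd4 : d % 4 = 1)
    (Wd : WeierstrassCurve ℚ) [Wd.IsElliptic] [Wd.IsGloballyMinimal]
    {Cd : VariableChange ℚ} (hCd : Cd • W.quadraticTwist (d : ℚ) = Wd) (hSelWd : Nat.card (Wd.selmerGroup 2) = 1) :
    (W.quadraticTwist (d : ℚ)).entireLFunction 1 ≠ 0 := by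
  haveI : Fact (Nat.Prime 2) := ⟨Nat.prime_two⟩
  have hd0 : ((d : ℤ) : ℚ) ≠ 0 := by exact_mod_cast (show d ≠ 0 by omega)
  haveI := W.isElliptic_quadraticTwist hd0
  have hcork : Wd.selmerCorank 2 = 0 :=
    (selmerCorank_eq_zero_of_natCard_selmerGroup_eq_one exists_casselsTate_pairing_holds Wd 2 hSelWd).1
  obtain ⟨hcm', ⟨hgo, hm⟩, -⟩ := not_hasCM_and_semistableOrdinary_twin_of_discr_eq_neg_prime W hcm hred hℓ hdℓ hd4 Wd hCd
  have hr0 : Wd.analyticRank = 0 := by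
    rcases hred with h | h
    · exact hC0g Wd hcm' (hgo h) hcork
    · exact hC0m Wd hcm' (hm h) hcork
  have hLWd : Wd.entireLFunction 1 ≠ 0 := (Wd.analyticRank_eq_zero_iff_holds (hmod Wd)).mp hr0
  rwa [← hCd, entireLFunction_smul] at hLWd

/-- **From `#Sel₂(Wd) = 1` to `L(W^{(d)},1) ≠ 0` through a rank-zero `2`-converse on ALL reduction types** (§0 without the reduction
clause): with `hC0` = «non-CM, globally minimal, `corank_{ℤ₂} Sel_{2^∞} = 0` ⟹ `r_an = 0`», a globally minimal model `Wd` of `W^{(d)}`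
(`d ≠ 0`, `W` non-CM) with `#Sel₂(Wd) = 1` has `L(W^{(d)},1) ≠ 0`.  Non-CM passes to the twin because `HasCM` depends only on `j`
(`j(W^{(d)}) = j(W)`).  CONDITIONAL on `hC0` and `hasEntireLFunction_rat`.  [cite: SilvermanAEC2009, X.4 Thm. 4.2, X.5 Cor. 5.4, App. C §11, §16] -/
theorem entireLFunction_twist_one_ne_zero_of_rankZeroTwoConverse_of_natCard_selmerGroup_eq_one
    (hC0 : ∀ (V : WeierstrassCurve ℚ) [V.IsElliptic] [V.IsGloballyMinimal], ¬ V.HasCM → V.selmerCorank 2 = 0 → V.analyticRank = 0)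
    (hmod : hasEntireLFunction_rat)
    (W : WeierstrassCurve ℚ) [W.IsElliptic] (hcm : ¬ W.HasCM)
    {d : ℚ} (hd0 : d ≠ 0) (Wd : WeierstrassCurve ℚ) [Wd.IsElliptic] [Wd.IsGloballyMinimal]
    {Cd : VariableChange ℚ} (hCd : Cd • W.quadraticTwist d = Wd) (hSelWd : Nat.card (Wd.selmerGroup 2) = 1) :
    (W.quadraticTwist d).entireLFunction 1 ≠ 0 := by
  haveI : Fact (Nat.Prime 2) := ⟨Nat.prime_two⟩
  haveI := W.isElliptic_quadraticTwist hd0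
  have hcork : Wd.selmerCorank 2 = 0 :=
    (selmerCorank_eq_zero_of_natCard_selmerGroup_eq_one exists_casselsTate_pairing_holds Wd 2 hSelWd).1
  have hj : Wd.j = W.j := by
    subst hCd
    rw [variableChange_j, W.j_quadraticTwist hd0]
  have hcm' : ¬ Wd.HasCM := fun h ↦ hcm ((hasCM_iff_of_j_eq hj).mp h)
  have hr0 : Wd.analyticRank = 0 := hC0 Wd hcm' hcork
  have hLWd : Wd.entireLFunction 1 ≠ 0 := (Wd.analyticRank_eq_zero_iff_holds (hmod Wd)).mp hr0
  rwa [← hCd, entireLFunction_smul] at hLWd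

/-- **The three-piece rank-zero `2`-converse**: the ITEMS `GoodOrdinaryRankZeroTwoConverse` (stmt-19218) and `MultiplicativeRankZeroTwoConverse`
(stmt-19219) together with a rank-zero `2`-converse OFF the semistable-ordinary locus at `2` (supersingular or additive at `2` — nobody's item;
the rank-`0` analogue of the route's declared residual `RankOneTwoConverseOffSemistableAtTwo`) give the converse on every non-CM globally
minimal curve (cases on the reduction type at `2`).  [folklore] -/
theorem rankZeroTwoConverse_of_items_of_offSemistable
    (hC0g : GoodOrdinaryRankZeroTwoConverse) (hC0m : MultiplicativeRankZeroTwoConverse)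
    (hC0r : ∀ (V : WeierstrassCurve ℚ) [V.IsElliptic] [V.IsGloballyMinimal], ¬ V.HasCM → ¬ (GoodOrd V 2 ∨ Mult V 2) →
      V.selmerCorank 2 = 0 → V.analyticRank = 0) :
    ∀ (V : WeierstrassCurve ℚ) [V.IsElliptic] [V.IsGloballyMinimal], ¬ V.HasCM → V.selmerCorank 2 = 0 → V.analyticRank = 0 := by
  intro V _ _ hcm hco
  by_cases h : GoodOrd V 2 ∨ Mult V 2
  · rcases h with hgo | hm
    · exact hC0g V hcm hgo hco
    · exact hC0m V hcm hm hco
  · exact hC0r V hcm h hco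

/-! ## §1 The `Δ < 0` cell: NV⁻ -/

/-- **NV⁻ ⟸ stmt-19218 + stmt-19219 (BY NAME) on the semistable-ordinary slice of the `Δ < 0` cell** (mod GZK + `hasEntireLFunction_rat`).
For `W/ℚ` globally minimal elliptic, non-CM, `r_an(W) = 1`, `#Sel₂(W) = 2`, `Δ_W < 0`, `ord₂ C(W) = 1` (idle here), good-ordinary or
multiplicative at `2`: the text of p773745's binder `hNVneg` — an imaginary quadratic `K = ℚ(√−ℓ)`, `ℓ` prime, `Sel₂(W)` NOT strict at `ℓ`,
`d_K` odd `≠ −3`, Heegner, `2` split, **`L(W^{(d_K)},1) ≠ 0`**.  Door-prime twin package (§0) + the L-value step through the two items.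
CONDITIONAL on the displayed hypotheses; proves nothing about BSD; closes nothing.  [cite: MazurRubin2010, Prop. 3.3, Cor. 3.4 (i), Lemma 3.5]
[cite: GrossLMS1991, §1 (p. 235), §9] [cite: KrizLi2019, Rem. 1.14] -/
theorem nonvanishingDoor_of_rankZeroTwoConverses_of_facts
    (hC0g : GoodOrdinaryRankZeroTwoConverse) (hC0m : MultiplicativeRankZeroTwoConverse)
    (hGZK : rank_eq_analyticRank_of_analyticRank_le_one) (hmod : hasEntireLFunction_rat) :
    ∀ (W : WeierstrassCurve ℚ) [W.IsElliptic] [W.IsGloballyMinimal] [NeZero (W.conductorNorm ℤ)],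
      ¬ W.HasCM → W.analyticRank = 1 → Nat.card (W.selmerGroup 2) = 2 → W.Δ < 0 → padicValNat 2 W.tamagawaProduct = 1 →
      (GoodOrd W 2 ∨ Mult W 2) →
      ∃ (K : Type) (_ : Field K) (_ : NumberField K),
        IsImaginaryQuadratic K ∧
        (∃ (ℓ : ℕ) (_ : Fact ℓ.Prime), NumberField.discr K = -(ℓ : ℤ) ∧
          ¬ W.selmerGroup 2 ≤ MazurRubin2010.strictLocalKer W ℚ_[ℓ] 2) ∧
        Odd (NumberField.discr K) ∧ NumberField.discr K ≠ -3 ∧ SatisfiesHeegnerHypothesis (W.conductorNorm ℤ) K ∧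
        ((Ideal.span {(2 : ℤ)}).primesOver (𝓞 K)).ncard = 2 ∧
        (W.quadraticTwist (NumberField.discr K : ℚ)).entireLFunction 1 ≠ 0 := by
  intro W _ _ _ hcm hr hSel hΔ _hC1 hred
  obtain ⟨-, hsurjΔ⟩ := rank_eq_one_and_surj_of_natCard_selmerGroup_eq_two_of_GZK hGZK W hr hSel
  obtain ⟨K, iF, iN, ℓ, hℓF, hK, hd, hns, hodd, h3, hH, h2K, hd4, Wd, iE, iM, Cd, hCd, hSelWd⟩ :=
    exists_doorPrime_heegnerField_selmerTrivialTwin W hΔ (hsurjΔ hΔ) hSel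
  exact ⟨K, iF, iN, hK, ⟨ℓ, hℓF, hd, hns⟩, hodd, h3, hH, h2K,
    entireLFunction_twist_one_ne_zero_of_rankZeroTwoConverses_of_natCard_selmerGroup_eq_one hC0g hC0m hmod W hcm hred hℓF.out hd hd4
      Wd hCd hSelWd⟩

/-- **NV⁻ VERBATIM ⟸ a rank-zero `2`-converse on all non-CM curves** (mod GZK + `hasEntireLFunction_rat`): p773745's binder `hNVneg`
(`…AnalyticSplit` §2/§4), letter for letter, from `hC0` (= stmt-19218 + stmt-19219 + the off-semistable residual,
`rankZeroTwoConverse_of_items_of_offSemistable`).  CONDITIONAL on the displayed hypotheses; proves nothing about BSD; closes nothing.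
[cite: MazurRubin2010, Prop. 3.3, Cor. 3.4 (i), Lemma 3.5] [cite: GrossLMS1991, §1, §9] [cite: KrizLi2019, Rem. 1.14] -/
theorem nonvanishingDoor_of_rankZeroTwoConverse_of_facts
    (hC0 : ∀ (V : WeierstrassCurve ℚ) [V.IsElliptic] [V.IsGloballyMinimal], ¬ V.HasCM → V.selmerCorank 2 = 0 → V.analyticRank = 0)
    (hGZK : rank_eq_analyticRank_of_analyticRank_le_one) (hmod : hasEntireLFunction_rat) :
    ∀ (W : WeierstrassCurve ℚ) [W.IsElliptic] [W.IsGloballyMinimal] [NeZero (W.conductorNorm ℤ)],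
      ¬ W.HasCM → W.analyticRank = 1 → Nat.card (W.selmerGroup 2) = 2 → W.Δ < 0 → padicValNat 2 W.tamagawaProduct = 1 →
      ∃ (K : Type) (_ : Field K) (_ : NumberField K),
        IsImaginaryQuadratic K ∧
        (∃ (ℓ : ℕ) (_ : Fact ℓ.Prime), NumberField.discr K = -(ℓ : ℤ) ∧
          ¬ W.selmerGroup 2 ≤ MazurRubin2010.strictLocalKer W ℚ_[ℓ] 2) ∧
        Odd (NumberField.discr K) ∧ NumberField.discr K ≠ -3 ∧ SatisfiesHeegnerHypothesis (W.conductorNorm ℤ) K ∧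
        ((Ideal.span {(2 : ℤ)}).primesOver (𝓞 K)).ncard = 2 ∧
        (W.quadraticTwist (NumberField.discr K : ℚ)).entireLFunction 1 ≠ 0 := by
  intro W _ _ _ hcm hr hSel hΔ _hC1
  obtain ⟨-, hsurjΔ⟩ := rank_eq_one_and_surj_of_natCard_selmerGroup_eq_two_of_GZK hGZK W hr hSel
  obtain ⟨K, iF, iN, ℓ, hℓF, hK, hd, hns, hodd, h3, hH, h2K, -, Wd, iE, iM, Cd, hCd, hSelWd⟩ :=
    exists_doorPrime_heegnerField_selmerTrivialTwin W hΔ (hsurjΔ hΔ) hSel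
  have hD0 : (NumberField.discr K : ℚ) ≠ 0 := by exact_mod_cast NumberField.discr_ne_zero K
  exact ⟨K, iF, iN, hK, ⟨ℓ, hℓF, hd, hns⟩, hodd, h3, hH, h2K,
    entireLFunction_twist_one_ne_zero_of_rankZeroTwoConverse_of_natCard_selmerGroup_eq_one hC0 hmod W hcm hD0 Wd hCd hSelWd⟩

/-! ## §2 The egg cell: NV⁺ -/

/-- **NV⁺ ⟸ stmt-19218 + stmt-19219 (BY NAME) on the semistable-ordinary slice of the egg cell** (mod GZK + `hasEntireLFunction_rat`).
For `W/ℚ` globally minimal elliptic, non-CM, `r_an(W) = 1`, `#Sel₂(W) = 2`, `C(W)` odd (idle here), `ρ̄_{W,2}` onto, `Δ_W > 0`, MEETING THE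
EGG, good-ordinary or multiplicative at `2`: the text of p773745's binder `hNVpos` — `K = ℚ(√−ℓ)`, `ℓ` prime with the `2`-division cubic
ROOTLESS mod `ℓ`, `d_K` odd `≠ −3`, Heegner, **`L(W^{(d_K)},1) ≠ 0`**.  Silent-prime twin package (§0) + the L-value step through the two items.
CONDITIONAL on the displayed hypotheses; proves nothing about BSD; closes nothing.  [cite: Kramer1981, §2 Props. 3, 6]
[cite: MazurRubin2010, Cor. 3.4 (i)] [cite: SerreAbelianLadic1968, Ch. I §2.2, Cor. 2 (a)] [cite: KrizLi2019, Rem. 1.14] -/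
theorem nonvanishingSilent_of_rankZeroTwoConverses_of_facts
    (hC0g : GoodOrdinaryRankZeroTwoConverse) (hC0m : MultiplicativeRankZeroTwoConverse)
    (hGZK : rank_eq_analyticRank_of_analyticRank_le_one) (hmod : hasEntireLFunction_rat) :
    ∀ (W : WeierstrassCurve ℚ) [W.IsElliptic] [W.IsGloballyMinimal] [NeZero (W.conductorNorm ℤ)],
      ¬ W.HasCM → W.analyticRank = 1 → Nat.card (W.selmerGroup 2) = 2 → Odd W.tamagawaProduct → W.HasSurjectiveModNGaloisRep 2 →
      0 < W.Δ → MeetsEgg W → (GoodOrd W 2 ∨ Mult W 2) →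
      ∃ (K : Type) (_ : Field K) (_ : NumberField K),
        IsImaginaryQuadratic K ∧
        (∃ ℓ : ℕ, ℓ.Prime ∧ NumberField.discr K = -(ℓ : ℤ) ∧
          ∀ x : ZMod ℓ, 4 * x ^ 3 + ((integralModelInt W).b₂ : ZMod ℓ) * x ^ 2 +
            2 * ((integralModelInt W).b₄ : ZMod ℓ) * x + ((integralModelInt W).b₆ : ZMod ℓ) ≠ 0) ∧
        Odd (NumberField.discr K) ∧ NumberField.discr K ≠ -3 ∧ SatisfiesHeegnerHypothesis (W.conductorNorm ℤ) K ∧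
        (W.quadraticTwist (NumberField.discr K : ℚ)).entireLFunction 1 ≠ 0 := by
  intro W _ _ _ hcm hr hSel _hT hsurj hΔ hegg hred
  obtain ⟨K, iF, iN, ℓ, hℓ, hK, hd, hsil, hodd, h3, hH, hd4, Wd, iE, iM, Cd, hCd, hSelWd⟩ :=
    exists_silentPrime_heegnerField_selmerTrivialTwin_of_GZK hGZK W hΔ hsurj hr hSel hegg
  exact ⟨K, iF, iN, hK, ⟨ℓ, hℓ, hd, hsil⟩, hodd, h3, hH,
    entireLFunction_twist_one_ne_zero_of_rankZeroTwoConverses_of_natCard_selmerGroup_eq_one hC0g hC0m hmod W hcm hred hℓ hd hd4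
      Wd hCd hSelWd⟩

/-- **NV⁺ VERBATIM ⟸ a rank-zero `2`-converse on all non-CM curves** (mod GZK + `hasEntireLFunction_rat`): p773745's binder `hNVpos`
(`…AnalyticSplit` §3/§4), letter for letter, from `hC0`.  CONDITIONAL on the displayed hypotheses; proves nothing about BSD; closes nothing.
[cite: Kramer1981, §2 Props. 3, 6] [cite: MazurRubin2010, Cor. 3.4 (i)] [cite: SerreAbelianLadic1968, Ch. I §2.2, Cor. 2 (a)] [cite: KrizLi2019, Rem. 1.14] -/
theorem nonvanishingSilent_of_rankZeroTwoConverse_of_facts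
    (hC0 : ∀ (V : WeierstrassCurve ℚ) [V.IsElliptic] [V.IsGloballyMinimal], ¬ V.HasCM → V.selmerCorank 2 = 0 → V.analyticRank = 0)
    (hGZK : rank_eq_analyticRank_of_analyticRank_le_one) (hmod : hasEntireLFunction_rat) :
    ∀ (W : WeierstrassCurve ℚ) [W.IsElliptic] [W.IsGloballyMinimal] [NeZero (W.conductorNorm ℤ)],
      ¬ W.HasCM → W.analyticRank = 1 → Nat.card (W.selmerGroup 2) = 2 → Odd W.tamagawaProduct → W.HasSurjectiveModNGaloisRep 2 →
      0 < W.Δ → MeetsEgg W →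
      ∃ (K : Type) (_ : Field K) (_ : NumberField K),
        IsImaginaryQuadratic K ∧
        (∃ ℓ : ℕ, ℓ.Prime ∧ NumberField.discr K = -(ℓ : ℤ) ∧
          ∀ x : ZMod ℓ, 4 * x ^ 3 + ((integralModelInt W).b₂ : ZMod ℓ) * x ^ 2 +
            2 * ((integralModelInt W).b₄ : ZMod ℓ) * x + ((integralModelInt W).b₆ : ZMod ℓ) ≠ 0) ∧
        Odd (NumberField.discr K) ∧ NumberField.discr K ≠ -3 ∧ SatisfiesHeegnerHypothesis (W.conductorNorm ℤ) K ∧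
        (W.quadraticTwist (NumberField.discr K : ℚ)).entireLFunction 1 ≠ 0 := by
  intro W _ _ _ hcm hr hSel _hT hsurj hΔ hegg
  obtain ⟨K, iF, iN, ℓ, hℓ, hK, hd, hsil, hodd, h3, hH, -, Wd, iE, iM, Cd, hCd, hSelWd⟩ :=
    exists_silentPrime_heegnerField_selmerTrivialTwin_of_GZK hGZK W hΔ hsurj hr hSel hegg
  have hD0 : (NumberField.discr K : ℚ) ≠ 0 := by exact_mod_cast NumberField.discr_ne_zero K
  exact ⟨K, iF, iN, hK, ⟨ℓ, hℓ, hd, hsil⟩, hodd, h3, hH,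
    entireLFunction_twist_one_ne_zero_of_rankZeroTwoConverse_of_natCard_selmerGroup_eq_one hC0 hmod W hcm hD0 Wd hCd hSelWd⟩

end Summit.BirchSwinnertonDyer.BirchSwinnertonDyer.Theorems.GenusExact.TwinSwap.Ledger.Line25

end
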